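import Mathlib
import Literature.NumberTheory.Automorphic.HilbertModularFormQExpansion
import Summits.Langlands.Langlands.Theorems.CapacityClassicalityHilbertIntegralOverconvergentIsCongruenceThetaSeedCoeff
import Summits.Langlands.Langlands.Theorems.CapacityClassicalityHilbertIntegralOverconvergentIsCongruenceStubThetaQSeries
import Summits.Langlands.Langlands.Theorems.CapacityClassicalityHilbertIntegralOverconvergentIsCongruenceStubThetaDualProps
import Summits.Langlands.Langlands.Theorems.CapacityClassicalityHilbertIntegralOverconvergentIsCongruenceStubThetaInversionImaginary
import Summits.Langlands.Langlands.Theorems.CapacityClassicalityHilbertIntegralOverconvergentIsCongruenceStubImaginaryOrthantIdentity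
import Summits.Langlands.Langlands.Theorems.CapacityClassicalityHilbertIntegralOverconvergentIsCongruenceStubLowerUnipotentOfInversion
import Summits.Langlands.Langlands.Theorems.CapacityClassicalityHilbertIntegralOverconvergentIsCongruenceStubGamma1LeClosure
import Summits.Langlands.Langlands.Theorems.CapacityClassicalityHilbertIntegralOverconvergentIsCongruenceStubTransformOfClosure
import Summits.Langlands.Langlands.Theorems.CapacityClassicalityHilbertIntegralOverconvergentIsCongruenceStubConjPrincipalCongruence
import Summits.Langlands.Langlands.Theorems.CapacityClassicalityHilbertIntegralOverconvergentIsCongruenceStubSlashMul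
import Summits.Langlands.Langlands.Theorems.CapacityClassicalityHilbertIntegralOverconvergentIsCongruenceHilbertClassicalityAdmissibleExists

/-!
# The theta seed: `Seed.ItemNonconstantForm 2` (line Sketch-ideate-r1-k1, § V, stub V8 — the lead's composition)

Composition stub `stub_thetaSeed` of line Sketch-ideate-r1-k1 of the crux
`HilbertIntegralOverconvergentIsCongruence` (stmt-Langlands-8485), RESHAPE 18 (§ V): over every totally
real field `F` of degree `d ≥ 2` there is a NON-CONSTANT Hilbert modular form of parallel weight `2` with
INTEGER Fourier coefficients — namely `Θ⁴ · 1_ℍ` of level `Γ₁((4 d_F))`, where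
`Θ(z) = ∑_{x ∈ 𝓞F} e^{2πi S(x² z)}` is the theta series of one square (`thetaSeed`).  With § U
(`supplyFromSeed`) this discharges the supply item (ii) of the typed crux for every parallel even weight.

Proof (stubs V1–V7 of the line, all landed, + the landed Koecher principle and `q`-series package):
* `q`-expansion side (V1 `stub_theta_qSeries`, file `…ThetaSeedCoeff`): on `ℍ`, `Θ` is the `q`-series
  with coefficients `r(ν) = #{x ∈ 𝓞F : x² = ν} ∈ ℕ`, so `Θ` is holomorphic and `𝓞F`-periodic, and by the
  product formula `Θ² = Θ·Θ`, `Θ⁴ = Θ²·Θ²` have `ℕ`-valued coefficients with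
  `a₁(Θ⁴) ≥ a₀(Θ²) a₁(Θ²) ≥ r(0)² · r(0) r(1) = 2 ≠ 0`;
* theta inversion on `ℍ^d` (`ts_theta4_inversion`): `Θ(-1/w)⁴ = |d_F|^{-2} (-4)^{-d} ∏_σ w_σ² Θ'(w/4)⁴`
  with the dual theta series `Θ'(z) = ∑_{ξ ∈ 𝔡⁻¹} e^{2πi S(ξ² z)}` — both sides are holomorphic (V1, V2
  `stub_thetaDual_props`) and agree on the imaginary orthant by Hecke's transformation formula (V3
  `stub_theta_inversion_imaginary`, from the tree's `thetaIdeal_inv_holds`), hence everywhere (V4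
  `stub_imaginary_orthant_identity`);
* the weight-`2` law (`ts_gamma1_law`): for translations by periodicity, for the lower unipotents
  `(1 0; c 1)`, `c ∈ (4 d_F)`, from the inversion formula and the `𝔡`-periodicity of `Θ'` (V5
  `stub_lower_unipotent_of_inversion`, V2; `c/4 ∈ d_F 𝓞F ⊆ 𝔡` by Mathlib's `discr_mem_differentIdeal`),
  hence on the generated subgroup (V7 `stub_transform_of_closure`), which contains `Γ₁((4 d_F))` by
  Vaserstein's theorem (V6 `stub_gamma1_le_closure`);
* regularity at the cusps by the landed Koecher principle (`koecherPrinciple`, `[F:ℚ] ≥ 2`).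
-/

set_option linter.dupNamespace false

noncomputable section

namespace Summit.Langlands.Langlands.Theorems.HilbertIntegralOverconvergentIsCongruence

open MeasureTheory Complex NumberField
open Literature.NumberTheory.Automorphic Literature.NumberTheory.Automorphic.HilbertModular
open scoped MatrixGroups

/-- **The weight-`2` law on `Γ₁((q))` from periodicity and an inversion formula.** Over a totally real
`F` of degree `≥ 2`, `q ≠ 0`: if `Φ` is `𝓞F`-periodic on `ℍ`, `Φ(-1/w) = C ∏_σ w_σ² Ψ(w)` on `ℍ` and `Ψ` is
`(q)`-periodic on `ℍ`, then `Φ(γz) = J_2(γ, z) Φ(z)` for all `γ ∈ Γ₁((q))`, `z ∈ ℍ`: the law holds for the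
translations (periodicity; `kp_moeb_transl`) and for the lower unipotents `(1 0; c 1)`, `c ∈ (q)` (stub V5),
hence on the subgroup they generate (stub V7), which contains `Γ₁((q))` by Vaserstein's theorem (stub V6). [folklore] -/
theorem ts_gamma1_law (F : Type) [Field F] [NumberField F] [NumberField.IsTotallyReal F]
    (hd : 1 < Module.finrank ℚ F) (q : 𝓞 F) (hq : q ≠ 0) (Φ Ψ : Point F → ℂ) (C : ℂ)
    (hperΦ : ∀ (b : 𝓞 F) (z : Point F), z ∈ halfSpace F → Φ (fun σ ↦ z σ + ((σ (b : F) : ℝ) : ℂ)) = Φ z)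
    (hinv : ∀ w ∈ halfSpace F, Φ (fun σ ↦ -(w σ)⁻¹) = C * (∏ σ : F →+* ℝ, w σ ^ 2) * Ψ w)
    (hperΨ : ∀ c ∈ Ideal.span {q}, ∀ w ∈ halfSpace F, Ψ (fun σ ↦ w σ + ((σ (c : F) : ℝ) : ℂ)) = Ψ w) :
    ∀ γ ∈ Bianchi.Gamma1 (Ideal.span {q}), ∀ z ∈ halfSpace F,
      Φ (moeb (toSL2F γ) z) = autFactor (fun _ ↦ (2 : ℤ)) (toSL2F γ) z * Φ z := by
  intro γ hγ
  have hgen : ∀ γ ∈ (Set.range fun b : 𝓞 F ↦ SL2Rel.e12 b) ∪ (SL2Rel.e21 '' (Ideal.span {q} : Set (𝓞 F))),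
      ∀ z ∈ halfSpace F, Φ (moeb (toSL2F γ) z) = autFactor (fun _ ↦ (2 : ℤ)) (toSL2F γ) z * Φ z := by
    rintro γ (⟨b, rfl⟩ | ⟨c, hc, rfl⟩) z hz
    · obtain ⟨hmoeb, haut⟩ := kp_moeb_transl (cpc_coe_toSL2F_e12 b) (fun _ ↦ (2 : ℤ)) z
      rw [hmoeb, haut, one_mul, hperΦ b z hz]
    · exact stub_lower_unipotent_of_inversion F Φ Ψ C (Ideal.span {q}) hinv hperΨ c hc z hz
  exact stub_transform_of_closure F (fun _ ↦ (2 : ℤ)) Φ _ hgen γ (stub_gamma1_le_closure F hd q hq hγ)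

/-- `w ↦ -1/w` (coordinatewise) maps `ℍ` to `ℍ`. [folklore] -/
theorem ts_neg_inv_mem_halfSpace {F : Type} [Field F] [NumberField F] {w : Point F}
    (hw : w ∈ halfSpace F) : (fun σ ↦ -(w σ)⁻¹) ∈ halfSpace F := fun σ ↦ by
  have h := hw σ
  have hn : 0 < Complex.normSq (w σ) := Complex.normSq_pos.2 fun h0 ↦ by simp [h0] at h
  simp only [Complex.neg_im, Complex.inv_im, neg_div, neg_neg]
  exact div_pos h hn

/-- `w ↦ -1/w` (coordinatewise) is holomorphic on `ℍ`. [folklore] -/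
theorem ts_differentiableOn_neg_inv (F : Type) [Field F] [NumberField F] :
    DifferentiableOn ℂ (fun w : Point F ↦ fun σ ↦ -(w σ)⁻¹) (halfSpace F) :=
  differentiableOn_pi.2 fun σ ↦ (((differentiableOn_apply (𝕜 := ℂ) σ _)).inv fun w hw h0 ↦ by
    have h := (hw : w ∈ halfSpace F) σ; simp [h0] at h).neg

/-- `w ↦ w/4` (coordinatewise) maps `ℍ` to `ℍ` and is holomorphic. [folklore] -/
theorem ts_quarter_props (F : Type) [Field F] [NumberField F] :
    (∀ w ∈ halfSpace F, (fun σ ↦ w σ / 4 : Point F) ∈ halfSpace F) ∧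
    Differentiable ℂ (fun w : Point F ↦ fun σ ↦ w σ / 4) := by
  refine ⟨fun w hw σ ↦ ?_, ?_⟩
  · have h := hw σ
    simp only [Complex.div_ofNat_im]
    positivity
  · have heq : (fun w : Point F ↦ fun σ ↦ w σ / 4) = fun w ↦ (4 : ℂ)⁻¹ • w := by
      funext w σ
      simp only [Pi.smul_apply, smul_eq_mul]
      ring
    rw [heq]
    exact (differentiable_id (𝕜 := ℂ) (E := Point F)).const_smul ((4 : ℂ)⁻¹)

/-- `w ↦ ∏_σ w_σ²` is holomorphic. [folklore] -/
theorem ts_differentiable_prod_sq (F : Type) [Field F] [NumberField F] :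
    Differentiable ℂ (fun w : Point F ↦ ∏ σ : F →+* ℝ, w σ ^ 2) := by
  intro w
  have h : ∀ σ ∈ (Finset.univ : Finset (F →+* ℝ)), DifferentiableAt ℂ (fun w : Point F ↦ w σ ^ 2) w :=
    fun σ _ ↦ (differentiableAt_apply (𝕜 := ℂ) σ w).pow 2
  classical
  have := HasFDerivAt.finsetProd (u := Finset.univ) (fun σ hσ ↦ (h σ hσ).hasFDerivAt)
  simpa [Finset.prod_fn] using this.differentiableAt


/-- **Theta inversion for `Θ⁴` on `ℍ^d`.** For `w ∈ ℍ`: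
`Θ(-1/w)⁴ = |d_F|^{-2} (-4)^{-d} ∏_σ w_σ² · Θ'(w/4)⁴`, where `Θ(z) = ∑_{x ∈ 𝓞F} e^{2πi S(x²z)}` and
`Θ'(z) = ∑_{ξ ∈ 𝔡⁻¹} e^{2πi S(ξ²z)}`: both sides are holomorphic in `w ∈ ℍ^d` (stubs V1, V2 and the landed
`qSeriesPackage`), and they agree on the imaginary orthant `w = iy` by Hecke's transformation formula (stub V3 at
the height `y/4`: `Θ(i/y) = |d_F|^{-1/2} ∏_σ (y_σ/2)^{1/2} Θ'(iy/4)`), hence everywhere (stub V4).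
[cite: NeukirchANT1999, Ch. VII (3.6), (5.7)] -/
theorem ts_theta4_inversion (F : Type) [Field F] [NumberField F] [NumberField.IsTotallyReal F] :
    ∀ w ∈ halfSpace F,
      (∑' x : 𝓞 F, cexp (2 * Real.pi * I * pairing (((x : 𝓞 F) : F) ^ 2) (fun σ ↦ -(w σ)⁻¹))) ^ 4 =
        (((|(NumberField.discr F : ℝ)| ^ (-(1 / 2 : ℝ)) : ℝ) : ℂ) ^ 4 * ∏ _σ : F →+* ℝ, (-(4 : ℂ))⁻¹) *
          (∏ σ : F →+* ℝ, w σ ^ 2) *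
          (∑' ξ : {ν : F | ∀ a : 𝓞 F, ∃ n : ℤ, Algebra.trace ℚ F (ν * a) = n},
              cexp (2 * Real.pi * I * pairing ((ξ : F) ^ 2) (fun σ ↦ w σ / 4))) ^ 4 := by
  obtain ⟨hgauss, habs, hθQ, -, -, -, -⟩ := stub_theta_qSeries F
  obtain ⟨hθ'hol, -⟩ := stub_thetaDual_props F hgauss
  set D : Set F := {ν : F | ∀ a : 𝓞 F, ∃ n : ℤ, Algebra.trace ℚ F (ν * a) = n} with hD
  set θ : Point F → ℂ :=
    fun z ↦ ∑' x : 𝓞 F, cexp (2 * Real.pi * I * pairing (((x : 𝓞 F) : F) ^ 2) z) with hθ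
  set θ' : Point F → ℂ := fun z ↦ ∑' ξ : D, cexp (2 * Real.pi * I * pairing ((ξ : F) ^ 2) z) with hθ'
  set A : ℂ := ((|(NumberField.discr F : ℝ)| ^ (-(1 / 2 : ℝ)) : ℝ) : ℂ) with hA
  set C : ℂ := A ^ 4 * ∏ _σ : F →+* ℝ, (-(4 : ℂ))⁻¹ with hC
  have hθhol : IsHolomorphicOn F θ :=
    ts_isHolomorphicOn_congr hθQ
      (qSeriesPackage F (fun ν ↦ ((Nat.card {x : 𝓞 F // ((x : 𝓞 F) : F) ^ 2 = ν} : ℕ) : ℂ)) habs).1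
  set f₁ : Point F → ℂ := fun w ↦ (θ (fun σ ↦ -(w σ)⁻¹)) ^ 4 with hf₁
  set g₁ : Point F → ℂ := fun w ↦ C * (∏ σ : F →+* ℝ, w σ ^ 2) * (θ' (fun σ ↦ w σ / 4)) ^ 4 with hg₁
  have h1 : IsHolomorphicOn F f₁ :=
    (hθhol.comp (ts_differentiableOn_neg_inv F) fun w hw ↦ ts_neg_inv_mem_halfSpace hw).pow 4
  have h2 : IsHolomorphicOn F g₁ := by
    obtain ⟨hqmaps, hqdiff⟩ := ts_quarter_props F
    have h : DifferentiableOn ℂ (fun w : Point F ↦ θ' (fun σ ↦ w σ / 4)) (halfSpace F) :=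
      hθ'hol.comp hqdiff.differentiableOn fun w hw ↦ hqmaps w hw
    exact ((differentiableOn_const C).mul (ts_differentiable_prod_sq F).differentiableOn).mul (h.pow 4)
  have h3 : ∀ y : (F →+* ℝ) → ℝ, (∀ σ, 0 < y σ) →
      f₁ (fun σ ↦ ((y σ : ℝ) : ℂ) * I) = g₁ (fun σ ↦ ((y σ : ℝ) : ℂ) * I) := by
    intro y hy
    set y' : (F →+* ℝ) → ℝ := fun σ ↦ y σ / 4 with hy'
    have hy'pos : ∀ σ, 0 < y' σ := fun σ ↦ div_pos (hy σ) four_pos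
    have hV3 := stub_theta_inversion_imaginary F y' hy'pos
    have hpt1 : (fun σ ↦ -((((y σ : ℝ) : ℂ)) * I)⁻¹) = fun σ ↦ ((((4 * y' σ)⁻¹ : ℝ) : ℂ)) * I := by
      funext σ
      have h4 : (4 : ℝ) * y' σ = y σ := by rw [hy']; ring
      rw [h4, mul_inv, Complex.inv_I]
      push_cast
      ring
    have hpt2 : (fun σ ↦ ((y σ : ℝ) : ℂ) * I / 4) = fun σ ↦ ((y' σ : ℝ) : ℂ) * I := by
      funext σ; rw [hy']; push_cast; ring
    have hP : (∏ σ : F →+* ℝ, ((Real.sqrt (2 * y' σ) : ℝ) : ℂ)) ^ 4 =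
        (∏ _σ : F →+* ℝ, (-(4 : ℂ))⁻¹) * ∏ σ : F →+* ℝ, (((y σ : ℝ) : ℂ) * I) ^ 2 := by
      rw [← Finset.prod_pow, ← Finset.prod_mul_distrib]
      refine Finset.prod_congr rfl fun σ _ ↦ ?_
      have h2 : (0 : ℝ) ≤ 2 * y' σ := (mul_pos two_pos (hy'pos σ)).le
      rw [← Complex.ofReal_pow, show (4 : ℕ) = 2 * 2 from rfl, pow_mul, Real.sq_sqrt h2,
        mul_pow ((y σ : ℝ) : ℂ) I 2, Complex.I_sq, hy']
      push_cast
      ring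
    simp only [hf₁, hg₁, hθ, hθ']
    rw [hpt1, hV3, hpt2, mul_pow, mul_pow, hP]
    ring
  intro w hw
  have key := stub_imaginary_orthant_identity F f₁ g₁ h1 h2 h3 w hw
  simpa only [hf₁, hg₁] using key

/-- **`Θ⁴` as a Hilbert modular form (data for stub V8).** Over every totally real field `F` of
degree `≥ 2` there is a Hilbert modular form of parallel weight `2` with integer Fourier coefficients and
non-zero coefficients at the indices `0` and `1`: `Θ⁴` (extended by `0` off `ℍ`), of level `Γ₁((4 d_F))`, where
`Θ(z) = ∑_{x ∈ 𝓞F} e^{2πi S(x²z)}`.  Holomorphy and the coefficients come from the `q`-series side (stub V1,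
`ts_natCoeff_of_qSeries`, `ts_natCoeff_mul`: `a₁(Θ⁴) ≥ a₀(Θ²) a₁(Θ²) ≥ 2`); the weight-`2` law on
`Γ₁((4 d_F))` from periodicity and theta inversion (`ts_theta4_inversion`, `ts_gamma1_law`, the `𝔡`-periodicity
of the dual theta series, stub V2, as `d_F ∈ 𝔡`); regularity at the cusps by the landed Koecher principle.
[folklore] -/
theorem thetaFourData (F : Type) [Field F] [NumberField F] [NumberField.IsTotallyReal F]
    (hd : 1 < Module.finrank ℚ F) :
    ∃ 𝔫 : Ideal (𝓞 F), 𝔫 ≠ ⊥ ∧ ∃ (h : Point F → ℂ) (zc : F → ℤ),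
      h ∈ modularForms (Bianchi.Gamma1 𝔫) (fun _ ↦ (2 : ℤ)) ∧
      (∀ ν ∈ qIndexSet F, fourierCoeff h ν = (zc ν : ℂ)) ∧
      fourierCoeff h 0 ≠ 0 ∧ fourierCoeff h 1 ≠ 0 := by
  classical
  obtain ⟨hgauss, habs, hθQ, hr0, hr1, hrsupp, hθper⟩ := stub_theta_qSeries F
  obtain ⟨-, hθ'per⟩ := stub_thetaDual_props F hgauss
  set D : Set F := {ν : F | ∀ a : 𝓞 F, ∃ n : ℤ, Algebra.trace ℚ F (ν * a) = n} with hD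
  set r : F → ℕ := fun ν ↦ Nat.card {x : 𝓞 F // ((x : 𝓞 F) : F) ^ 2 = ν} with hr
  set θ : Point F → ℂ :=
    fun z ↦ ∑' x : 𝓞 F, cexp (2 * Real.pi * I * pairing (((x : 𝓞 F) : F) ^ 2) z) with hθ
  set θ' : Point F → ℂ := fun z ↦ ∑' ξ : D, cexp (2 * Real.pi * I * pairing ((ξ : F) ^ 2) z) with hθ'
  -- (1) `Θ` is a `q`-series with coefficients `r(ν) ∈ ℕ`
  obtain ⟨hθhol, hθperH, hθcoeff⟩ := ts_natCoeff_of_qSeries F r θ habs hθQ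
  have hrz : ∀ μ : F, μ ∈ D → μ ∉ qIndexSet F → r μ = 0 := fun μ _ hμc ↦ by
    by_contra h
    exact hμc (hrsupp μ h)
  -- (2) coefficients of `Θ²` and `Θ⁴`
  obtain ⟨c₂, hc₂, hc₂z, hle₂⟩ :=
    ts_natCoeff_mul F θ θ hθhol hθhol hθperH hθperH r r hθcoeff hrz hθcoeff hrz
  have hθ2hol : IsHolomorphicOn F (θ * θ) := hθhol.mul hθhol
  have hθ2per : ∀ (b : 𝓞 F) (z : Point F), z ∈ halfSpace F →
      (θ * θ) (fun σ ↦ z σ + ((σ (b : F) : ℝ) : ℂ)) = (θ * θ) z := fun b z hz ↦ by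
    simp only [Pi.mul_apply, hθperH b z hz]
  obtain ⟨c₄, hc₄, -, hle₄⟩ :=
    ts_natCoeff_mul F (θ * θ) (θ * θ) hθ2hol hθ2hol hθ2per hθ2per c₂ c₂ hc₂ hc₂z hc₂ hc₂z
  have h1q : (1 : F) ∈ qIndexSet F := hcm_one_mem_qIndexSet F
  have h0q : (0 : F) ∈ qIndexSet F := zero_mem_qIndexSet
  have hc₄pos : 2 ≤ c₄ 1 := by
    have hr0' : r 0 = 1 := hr0
    have hr1' : r 1 = 2 := hr1
    have h01 : r 0 * r 1 ≤ c₂ 1 := by simpa using hle₂ 0 h0q 1 h1q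
    have h00 : r 0 * r 0 ≤ c₂ 0 := by simpa using hle₂ 0 h0q 0 h0q
    have h : c₂ 0 * c₂ 1 ≤ c₄ 1 := by simpa using hle₄ 0 h0q 1 h1q
    rw [hr0', hr1'] at h01
    rw [hr0'] at h00
    calc 2 = 1 * 1 * (1 * 2) := by norm_num
      _ ≤ c₂ 0 * c₂ 1 := Nat.mul_le_mul h00 h01
      _ ≤ c₄ 1 := h
  have hθ4 : θ ^ 4 = θ * θ * (θ * θ) := by
    rw [show (4 : ℕ) = 2 + 2 from rfl, pow_add, pow_two]
  -- (3) the level `(4 d_F)` and the transformation law of `Θ⁴`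
  set dF : 𝓞 F := ((NumberField.discr F : ℤ) : 𝓞 F) with hdF
  set q : 𝓞 F := 4 * dF with hq
  have hdFmem : dF ∈ differentIdeal ℤ (𝓞 F) := NumberField.discr_mem_differentIdeal F (𝓞 F)
  have hdF0 : dF ≠ 0 := by
    rw [hdF]
    exact Int.cast_ne_zero.2 (NumberField.discr_ne_zero F)
  have hq0 : q ≠ 0 := mul_ne_zero (by norm_num) hdF0
  have hJ : Ideal.span {q} ≠ ⊥ := by rwa [Ne, Ideal.span_singleton_eq_bot]
  set A : ℂ := ((|(NumberField.discr F : ℝ)| ^ (-(1 / 2 : ℝ)) : ℝ) : ℂ) with hA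
  set C : ℂ := A ^ 4 * ∏ _σ : F →+* ℝ, (-(4 : ℂ))⁻¹ with hC
  set Ψ : Point F → ℂ := fun w ↦ (θ' (fun σ ↦ w σ / 4)) ^ 4 with hΨ
  have hperΦ : ∀ (b : 𝓞 F) (z : Point F), z ∈ halfSpace F →
      (θ ^ 4) (fun σ ↦ z σ + ((σ (b : F) : ℝ) : ℂ)) = (θ ^ 4) z := fun b z _ ↦ by
    simp only [Pi.pow_apply, hθ, hθper b z]
  have hinv : ∀ w ∈ halfSpace F, (θ ^ 4) (fun σ ↦ -(w σ)⁻¹) = C * (∏ σ : F →+* ℝ, w σ ^ 2) * Ψ w :=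
    fun w hw ↦ ts_theta4_inversion F w hw
  have hperΨ : ∀ c ∈ Ideal.span {q}, ∀ w ∈ halfSpace F,
      Ψ (fun σ ↦ w σ + ((σ (c : F) : ℝ) : ℂ)) = Ψ w := by
    intro c hc w _
    obtain ⟨t, rfl⟩ := Ideal.mem_span_singleton'.1 hc
    have hmem : t * dF ∈ differentIdeal ℤ (𝓞 F) := Ideal.mul_mem_left _ t hdFmem
    have hpt : (fun σ ↦ (w σ + ((σ ((t * q : 𝓞 F) : F) : ℝ) : ℂ)) / 4) =
        fun σ ↦ w σ / 4 + ((σ ((t * dF : 𝓞 F) : F) : ℝ) : ℂ) := by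
      funext σ
      rw [hq, hdF]
      push_cast
      simp only [map_mul, map_intCast, map_ofNat]
      push_cast
      ring
    have key := hθ'per (t * dF) hmem (fun σ ↦ w σ / 4)
    simp only [hΨ, hθ']
    rw [hpt]
    beta_reduce at key ⊢
    rw [key]
  have hlaw := ts_gamma1_law F hd q hq0 (θ ^ 4) Ψ C hperΦ hinv hperΨ
  -- (4) the form `Θ⁴ · 1_ℍ`
  set f : Point F → ℂ := (halfSpace F).indicator (θ ^ 4) with hf
  have hfeq : ∀ z ∈ halfSpace F, f z = (θ ^ 4) z := fun z hz ↦ Set.indicator_of_mem hz _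
  have hθ4hol : IsHolomorphicOn F (θ ^ 4) := by
    change DifferentiableOn ℂ (fun z ↦ θ z ^ 4) (halfSpace F)
    exact hθhol.pow 4
  have hfhol : IsHolomorphicOn F f := ts_isHolomorphicOn_congr hfeq hθ4hol
  have hftrans : ∀ γ ∈ Bianchi.Gamma1 (Ideal.span {q}), ∀ z ∈ halfSpace F,
      f (moeb (toSL2F γ) z) = autFactor (fun _ ↦ (2 : ℤ)) (toSL2F γ) z * f z := fun γ hγ z hz ↦ by
    rw [hfeq z hz, hfeq _ (slm_moeb_mem_halfSpace _ hz), hlaw γ hγ z hz]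
  have hfzero : ∀ z ∉ halfSpace F, f z = 0 := fun z hz ↦ Set.indicator_of_notMem hz _
  have hmod : IsModularForm (Bianchi.Gamma1 (Ideal.span {q})) (fun _ ↦ (2 : ℤ)) f :=
    koecherPrinciple F hd (Ideal.span {q}) hJ _ (Bianchi.Gamma_le_Gamma1 _) _ f hfhol hftrans hfzero
  -- (5) the coefficients of the form
  have hfcoeff : ∀ ν : F, ν ∈ D → fourierCoeff f ν = (c₄ ν : ℂ) := fun ν hν ↦ by
    rw [ts_fourierCoeff_congr hfeq ν, hθ4]
    exact hc₄ ν hν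
  have hc₄zero : 1 ≤ c₄ 0 := by
    have hr0' : r 0 = 1 := hr0
    have h00 : r 0 * r 0 ≤ c₂ 0 := by simpa using hle₂ 0 h0q 0 h0q
    have h : c₂ 0 * c₂ 0 ≤ c₄ 0 := by simpa using hle₄ 0 h0q 0 h0q
    rw [hr0'] at h00
    calc 1 = 1 * 1 * (1 * 1) := by norm_num
      _ ≤ c₂ 0 * c₂ 0 := Nat.mul_le_mul h00 h00
      _ ≤ c₄ 0 := h
  refine ⟨Ideal.span {q}, hJ, f, fun ν ↦ (c₄ ν : ℤ), mem_modularForms_iff.2 hmod, fun ν hν ↦ ?_, ?_, ?_⟩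
  · rw [hfcoeff ν hν.1, Int.cast_natCast]
  · rw [hfcoeff 0 h0q.1]
    exact Nat.cast_ne_zero.2 (by omega)
  · rw [hfcoeff 1 h1q.1]
    exact Nat.cast_ne_zero.2 (by omega)

/-- **The theta seed (stub V8, `Seed.ItemNonconstantForm 2`).** Over every totally real field `F` of degree `≥ 2` there
is a Hilbert modular form of parallel weight `2` with integer Fourier coefficients and a non-zero coefficient at a
non-zero index (`Θ⁴ · 1_ℍ` of level `Γ₁((4 d_F))`, `thetaFourData`, index `ν = 1`). [folklore] -/
theorem thetaSeed (F : Type) [Field F] [NumberField F] [NumberField.IsTotallyReal F]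
    (hd : 1 < Module.finrank ℚ F) :
    ∃ 𝔫 : Ideal (𝓞 F), 𝔫 ≠ ⊥ ∧ ∃ (h : Point F → ℂ) (zc : F → ℤ),
      h ∈ modularForms (Bianchi.Gamma1 𝔫) (fun _ ↦ (2 : ℤ)) ∧
      (∀ ν ∈ qIndexSet F, fourierCoeff h ν = (zc ν : ℂ)) ∧
      ∃ ν ∈ qIndexSet F, ν ≠ 0 ∧ fourierCoeff h ν ≠ 0 := by
  obtain ⟨𝔫, h𝔫, h, zc, hh, hzc, -, h1⟩ := thetaFourData F hd
  exact ⟨𝔫, h𝔫, h, zc, hh, hzc, 1, hcm_one_mem_qIndexSet F, one_ne_zero, h1⟩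

end Summit.Langlands.Langlands.Theorems.HilbertIntegralOverconvergentIsCongruence
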